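import Mathlib
import HarnessLib
import Summits.AtomisticToContinuum.FouriersLaw.Theses.JunctionLocality
import Summits.AtomisticToContinuum.FouriersLaw.Theses.HonestZwanzig
import Summits.AtomisticToContinuum.FouriersLaw.Theorems.OddSectorIrreversibilityCorrectorTheoryUniformMixing

/-!
# Strategy census, seat s2 (instance CP) — typed companions for crux `JunctionLocality.ConductanceLowerBound`
(stmt-AtomisticToContinuum-11749; crux-strategist `cstrat-stmt-AtomisticToContinuum-11749-s2`, 2026-08-17)

Companion of `STRATEGY-CENSUS-s2-addendum-CP.md` (instance CP of the concurrently launched s2 seat).  It TYPES the new statements named there over existing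
declarations and PROVES the elementary implications the census quotes.  Nothing here is a line:
no `stub_*`, nothing is registered with `ledger skeleton check`; the live skeleton
`Lines/ForecastSensitivitySketch.lean` (lead c5) is untouched.

Contents
* §0 `corrJJ`, `gk`, `abelGK` — the equilibrium total-current autocorrelation of the open `N`-chain
  (VERBATIM the `corrJJ` of the landed `HonestZwanzig.OpenChainGreenKubo`, stmt-12696, proved by
  `openChainGreenKubo_holds`), its Green–Kubo integral and its Abel (Laplace) means.
* §1 Decomposition D-G (census §Decomposition): the ABEL-WINDOW SPLIT at an arbitrary rate sequence
  `Λ : ℕ → ℝ` — `BulkAbelFloorAt Λ` (extensive Abel mean at rate `Λ N`) and `NoSpectralHoleAt Λ`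
  (the DC value keeps a fraction `θ` of the Abel mean at rate `Λ N`) — with the glue
  `conductanceLowerBound_of_abelWindowAt : BulkAbelFloorAt Λ → NoSpectralHoleAt Λ → ConductanceLowerBound`
  PROVED (through the landed open-chain Green–Kubo identity and uniqueness of limits), and the
  pinned instance `Λ N = (N+1)^{-1/4}` (`BulkAbelFloor`, `NoSpectralHole`).
* §1b the MIDDLE-BOND sharpening: `BondShareGK` (fixed `N`, provable), `MidBondAbelFloorAt Λ`,
  `MidBondNoHoleAt Λ` with the glue `conductanceLowerBound_of_midBondWindowAt` PROVED and the rate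
  `midRate C₀ N = C₀ log(N+2)/(N+1)` (bulk-certifiable by locality up to that Abel time).
* §2 Strengthening / anchor (census §Strengthen S-C): `AbelAnchor` (extensivity of the Abel mean at
  every FIXED rate — provable, toothless) and `DcAcRatio`; glue `conductanceLowerBound_of_dcAcRatio`
  PROVED, so that `crux ⟺ DcAcRatio` modulo the anchor and a ceiling.
* §3 Strengthening S-A: `QuasiMonotoneResponse` with
  `conductanceLowerBound_of_quasiMonotone : QuasiMonotoneResponse → PositiveConductance → ConductanceLowerBound`
  PROVED, and `DoublingResistance` (stated; only a power law follows — census).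
-/

noncomputable section

open MeasureTheory Filter Topology
open scoped NNReal
open Literature.MathematicalPhysics.KineticTheory.HeatConduction

namespace Summit.AtomisticToContinuum.FouriersLaw.Cruxes.ConductanceLowerBound.StrategyCensus2CP

open Summit.AtomisticToContinuum.FouriersLaw.Theses.JunctionLocality

/-! ## §0 The open chain's equilibrium current autocorrelation, its GK integral and Abel means -/

/-- `corrJJ … N t = Cov_{μ_T}(J(X_0), J(X_t))` for the open `N`-chain with BOTH baths at `T`
(`J = Σ_i j_i` the total current, `X_t` the Langevin dynamics through the tree's
`OscillatorChain.transitionKernel`, `μ_T` the Gibbs state) — verbatim the `corrJJ` of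
`HonestZwanzig.OpenChainGreenKubo`. -/
def corrJJ (ω₂ lam β γ T : ℝ) (N : ℕ) (t : ℝ) : ℝ :=
  (∫ z, (fun z : PhaseSpace N => ∑ i : Fin N, (pinnedChain ω₂ lam β γ).bondCurrent N i z) z *
      (∫ y, (fun z : PhaseSpace N => ∑ i : Fin N, (pinnedChain ω₂ lam β γ).bondCurrent N i z) y
        ∂((pinnedChain ω₂ lam β γ).transitionKernel N T T t.toNNReal z))
      ∂((pinnedChain ω₂ lam β γ).gibbsMeasure N T)) -
    (∫ z, (fun z : PhaseSpace N => ∑ i : Fin N, (pinnedChain ω₂ lam β γ).bondCurrent N i z) z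
      ∂((pinnedChain ω₂ lam β γ).gibbsMeasure N T)) *
    (∫ z, (fun z : PhaseSpace N => ∑ i : Fin N, (pinnedChain ω₂ lam β γ).bondCurrent N i z) z
      ∂((pinnedChain ω₂ lam β γ).gibbsMeasure N T))

/-- The open-chain Green–Kubo integral `∫₀^∞ corrJJ = (N−1) T² D_N` (landed identity). -/
def gk (ω₂ lam β γ T : ℝ) (N : ℕ) : ℝ :=
  ∫ t in Set.Ioi (0 : ℝ), corrJJ ω₂ lam β γ T N t

/-- Abel (Laplace) mean of the current autocorrelation at rate `l`:
`abelGK … N l = ∫₀^∞ e^{−l t} corrJJ(t) dt = ⟨J, (l − L)⁻¹ J⟩_{μ_T}` — the zero-frequency current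
power smoothed over the time window `1/l`. -/
def abelGK (ω₂ lam β γ T : ℝ) (N : ℕ) (l : ℝ) : ℝ :=
  ∫ t in Set.Ioi (0 : ℝ), Real.exp (-(l * t)) * corrJJ ω₂ lam β γ T N t

/-- **The landed open-chain Green–Kubo identity, read back on `gk`**: in the crux frame, for `N ≥ 2`
the response coefficient IS `gk/((N−1)T²)` (uniqueness of limits along `𝓝[≠] 0`). -/
theorem response_eq_gk {ω₂ lam β γ : ℝ} (hω : 0 < ω₂) (hl : 0 < lam) (hβ : 0 < β) (hγ : 0 < γ)
    (huniq : ∀ (N : ℕ) (T_L T_R : ℝ), 0 < T_L → 0 < T_R → ∀ μ ν : Measure (PhaseSpace N),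
      (pinnedChain ω₂ lam β γ).IsSteadyState N T_L T_R μ →
      (pinnedChain ω₂ lam β γ).IsSteadyState N T_L T_R ν → μ = ν)
    {μ : (N : ℕ) → ℝ → ℝ → Measure (PhaseSpace N)}
    (hμ : ∀ (N : ℕ) (T_L T_R : ℝ), 0 < T_L → 0 < T_R →
      (pinnedChain ω₂ lam β γ).IsSteadyState N T_L T_R (μ N T_L T_R))
    {T : ℝ} (hT : 0 < T) {D : ℕ → ℝ}
    (hD : ∀ N : ℕ, Tendsto (fun δ : ℝ =>
      (pinnedChain ω₂ lam β γ).totalCurrent (μ N (T + δ / 2) (T - δ / 2)) / δ) (𝓝[≠] 0) (𝓝 (D N)))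
    {N : ℕ} (hN : 2 ≤ N) :
    D N = gk ω₂ lam β γ T N / (((N : ℝ) - 1) * T ^ 2) := by
  have h := Summit.AtomisticToContinuum.FouriersLaw.Theorems.OddSectorIrreversibility.Corrector.openChainGreenKubo_holds
    ω₂ lam β γ hω hl hβ hγ huniq μ hμ T hT N hN
  have h2 : Tendsto (fun δ : ℝ =>
      (pinnedChain ω₂ lam β γ).totalCurrent (μ N (T + δ / 2) (T - δ / 2)) / δ) (𝓝[≠] 0)
      (𝓝 (gk ω₂ lam β γ T N / (((N : ℝ) - 1) * T ^ 2))) := h.2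
  exact tendsto_nhds_unique (hD N) h2

/-! ## §1 Decomposition D-G: the Abel-window split at a rate sequence `Λ` -/

/-- **BULK ABEL FLOOR at rate `Λ`** (census D-G, piece 1): for all parameters and `T > 0` there are
`m > 0` and `N₁` with `abelGK N (Λ N) ≥ m·(N−1)T²` for `N ≥ N₁` — the Abel-smoothed zero-frequency
current power of the open chain is EXTENSIVE at the time window `1/Λ N`.  For `1/Λ N` below the
ballistic horizon (`1/Λ N ≲ N^{1/3}` for the total-current form) this is an infinite-volume
statement (locality), supplied by Green–Kubo positivity (`CoercivePulse.LinearSpread`,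
`FourierGreenKubo.GreenKubo`): the bulk half. -/
def BulkAbelFloorAt (Λ : ℕ → ℝ) : Prop :=
  ∀ ω₂ lam β γ : ℝ, 0 < ω₂ → 0 < lam → 0 < β → 0 < γ → ∀ T : ℝ, 0 < T →
    ∃ m : ℝ, 0 < m ∧ ∃ N₁ : ℕ, ∀ N : ℕ, N₁ ≤ N →
      m * (((N : ℝ) - 1) * T ^ 2) ≤ abelGK ω₂ lam β γ T N (Λ N)

/-- **NO SPECTRAL HOLE below rate `Λ`** (census D-G, piece 2): there are `θ > 0` and `N₂` with
`gk N ≥ θ · abelGK N (Λ N)` for `N ≥ N₂` — the DC value `∫₀^∞ corrJJ` keeps a fixed fraction of the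
Abel mean at rate `Λ N`: the late (`t ≳ 1/Λ N`) current autocorrelation of the OPEN chain carries no
cancelling negative mass.  This is the exchange half (open-chain hydrodynamic window); no engine in
print — the census's orphan. -/
def NoSpectralHoleAt (Λ : ℕ → ℝ) : Prop :=
  ∀ ω₂ lam β γ : ℝ, 0 < ω₂ → 0 < lam → 0 < β → 0 < γ → ∀ T : ℝ, 0 < T →
    ∃ θ : ℝ, 0 < θ ∧ ∃ N₂ : ℕ, ∀ N : ℕ, N₂ ≤ N →
      θ * abelGK ω₂ lam β γ T N (Λ N) ≤ gk ω₂ lam β γ T N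

/-- **GLUE (proved): `BulkAbelFloorAt Λ → NoSpectralHoleAt Λ → ConductanceLowerBound`** for every
rate sequence `Λ`; constant `c = θ·m`. -/
theorem conductanceLowerBound_of_abelWindowAt (Λ : ℕ → ℝ)
    (hB : BulkAbelFloorAt Λ) (hH : NoSpectralHoleAt Λ) : ConductanceLowerBound := by
  intro ω₂ lam β γ hω hl hβ hγ huniq μ hμ T hT D hD
  obtain ⟨m, hm, N₁, hN₁⟩ := hB ω₂ lam β γ hω hl hβ hγ T hT
  obtain ⟨θ, hθ, N₂, hN₂⟩ := hH ω₂ lam β γ hω hl hβ hγ T hT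
  refine ⟨θ * m, mul_pos hθ hm, max (max N₁ N₂) 2, fun N hN => ?_⟩
  have h1 : N₁ ≤ N := le_trans (le_trans (le_max_left _ _) (le_max_left _ _)) hN
  have h2 : N₂ ≤ N := le_trans (le_trans (le_max_right _ _) (le_max_left _ _)) hN
  have h3 : 2 ≤ N := le_trans (le_max_right _ _) hN
  have hpos : 0 < ((N : ℝ) - 1) * T ^ 2 := by
    have : (2 : ℝ) ≤ N := by exact_mod_cast h3
    have hN1 : 0 < (N : ℝ) - 1 := by linarith
    positivity
  rw [response_eq_gk hω hl hβ hγ huniq hμ hT hD h3, le_div_iff₀ hpos]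
  calc θ * m * (((N : ℝ) - 1) * T ^ 2) = θ * (m * (((N : ℝ) - 1) * T ^ 2)) := by ring
    _ ≤ θ * abelGK ω₂ lam β γ T N (Λ N) := mul_le_mul_of_nonneg_left (hN₁ N h1) hθ.le
    _ ≤ gk ω₂ lam β γ T N := hN₂ N h2

/-- The pinned mesoscopic rate `Λ N = (N+1)^{-1/4}` (Abel time `(N+1)^{1/4}`): any exponent `a < 1/3`
keeps the total-current Abel mean bulk-certifiable by locality (contact contamination `O(N^{3a}) ≪ N`). -/
def abelRate (N : ℕ) : ℝ := ((N : ℝ) + 1) ^ (-(1 / 4 : ℝ))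

theorem abelRate_pos (N : ℕ) : 0 < abelRate N := by
  unfold abelRate
  exact Real.rpow_pos_of_pos (by positivity) _

/-- `BulkAbelFloor := BulkAbelFloorAt abelRate` (census D-G, piece 1, pinned scale). -/
def BulkAbelFloor : Prop := BulkAbelFloorAt abelRate

/-- `NoSpectralHole := NoSpectralHoleAt abelRate` (census D-G, piece 2, pinned scale). -/
def NoSpectralHole : Prop := NoSpectralHoleAt abelRate

/-- **GLUE at the pinned scale (proved).** -/
theorem conductanceLowerBound_of_abelWindow (hB : BulkAbelFloor) (hH : NoSpectralHole) :
    ConductanceLowerBound :=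
  conductanceLowerBound_of_abelWindowAt abelRate hB hH

/-! ## §1b The middle-bond sharpening (bulk-certifiable up to Abel time `N / log N`) -/

/-- The middle bond index `⌊(N−1)/2⌋` (bond `(i, i+1)` exists for `N ≥ 2`). -/
def midIdx (N : ℕ) (h : 0 < N) : Fin N := ⟨(N - 1) / 2, by omega⟩

/-- `corrMidJ … N t = Cov_{μ_T}(j_mid(X_0), J(X_t))` — the middle-bond current against the total
current (same dynamics and state as `corrJJ`); `0` for the empty chain. -/
def corrMidJ (ω₂ lam β γ T : ℝ) (N : ℕ) (t : ℝ) : ℝ :=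
  if h : 0 < N then
    (∫ z, (pinnedChain ω₂ lam β γ).bondCurrent N (midIdx N h) z *
        (∫ y, (fun z : PhaseSpace N => ∑ i : Fin N, (pinnedChain ω₂ lam β γ).bondCurrent N i z) y
          ∂((pinnedChain ω₂ lam β γ).transitionKernel N T T t.toNNReal z))
        ∂((pinnedChain ω₂ lam β γ).gibbsMeasure N T)) -
      (∫ z, (pinnedChain ω₂ lam β γ).bondCurrent N (midIdx N h) z
        ∂((pinnedChain ω₂ lam β γ).gibbsMeasure N T)) *
      (∫ z, (fun z : PhaseSpace N => ∑ i : Fin N, (pinnedChain ω₂ lam β γ).bondCurrent N i z) z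
        ∂((pinnedChain ω₂ lam β γ).gibbsMeasure N T))
  else 0

/-- `gkMid = ∫₀^∞ corrMidJ` and its Abel means. -/
def gkMid (ω₂ lam β γ T : ℝ) (N : ℕ) : ℝ :=
  ∫ t in Set.Ioi (0 : ℝ), corrMidJ ω₂ lam β γ T N t

/-- Abel mean of `corrMidJ` at rate `l`. -/
def abelMid (ω₂ lam β γ T : ℝ) (N : ℕ) (l : ℝ) : ℝ :=
  ∫ t in Set.Ioi (0 : ℝ), Real.exp (-(l * t)) * corrMidJ ω₂ lam β γ T N t

/-- **BOND-SHARE of the Green–Kubo integral** (fixed `N`, provable, M): `gk N = (N−1)·gkMid N` for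
`N ≥ 2` — every bond's time-integrated correlation with the total current is the same
(`⟨j_{x−1} − j_x, u⟩ = ⟨A e_x, u⟩ = −⟨e_x, L u⟩ + ⟨e_x, S u⟩ = ⟨e_x, J⟩ + ⟨S e_x, u⟩ = 0` for interior
`x`: energy-profile stationarity + parity + `S e_x = 0` off the contacts), so `T² D_N = gkMid N`. -/
def BondShareGK : Prop :=
  ∀ ω₂ lam β γ : ℝ, 0 < ω₂ → 0 < lam → 0 < β → 0 < γ → ∀ T : ℝ, 0 < T → ∀ N : ℕ, 2 ≤ N →
    gk ω₂ lam β γ T N = ((N : ℝ) - 1) * gkMid ω₂ lam β γ T N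

/-- **MID-BOND BULK ABEL FLOOR at rate `Λ`**: `abelMid N (Λ N) ≥ m·T²` eventually.  Because `j_mid`
sits `N/2` sites from both contacts, locality makes this an infinite-volume statement for Abel times
`1/Λ N` up to `c·N/log N` (light cone from the middle never reaches the baths; Gibbs decay kills the
equal-time tail): `⇐` Green–Kubo positivity `liminf_{λ↓0} ∫₀^∞ e^{−λt} C_∞(t) dt > 0` + a light-cone
bound for the cubic-force chain (not in print: BCDM 2007 covers interaction degree ≤ ½ pinning degree). -/
def MidBondAbelFloorAt (Λ : ℕ → ℝ) : Prop :=
  ∀ ω₂ lam β γ : ℝ, 0 < ω₂ → 0 < lam → 0 < β → 0 < γ → ∀ T : ℝ, 0 < T →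
    ∃ m : ℝ, 0 < m ∧ ∃ N₁ : ℕ, ∀ N : ℕ, N₁ ≤ N → m * T ^ 2 ≤ abelMid ω₂ lam β γ T N (Λ N)

/-- **MID-BOND NO-HOLE below rate `Λ`**: `gkMid N ≥ θ·abelMid N (Λ N)` eventually — the late
(`t ≳ 1/Λ N`, beyond the ballistic horizon when `Λ N ≍ log N / N`) correlation of the middle-bond
current with the total current carries no cancelling negative mass: what reaches the contacts is
absorbed, not coherently returned to the middle.  Exact content (census): with `z = (−L)⁻¹ j_mid =
−Ẽ_{>mid} + γ g_R` (energy conservation) it is an upper bound on the even-sector overlap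
`λ⟨Ẽ_{>mid}, u_λ⟩ − λγ⟨g_R∘Π, u_λ⟩`; no engine in print — the orphan, sharpest form. -/
def MidBondNoHoleAt (Λ : ℕ → ℝ) : Prop :=
  ∀ ω₂ lam β γ : ℝ, 0 < ω₂ → 0 < lam → 0 < β → 0 < γ → ∀ T : ℝ, 0 < T →
    ∃ θ : ℝ, 0 < θ ∧ ∃ N₂ : ℕ, ∀ N : ℕ, N₂ ≤ N →
      θ * abelMid ω₂ lam β γ T N (Λ N) ≤ gkMid ω₂ lam β γ T N

/-- **GLUE (proved): `BondShareGK → MidBondAbelFloorAt Λ → MidBondNoHoleAt Λ → ConductanceLowerBound`**,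
constant `c = θ·m`. -/
theorem conductanceLowerBound_of_midBondWindowAt (Λ : ℕ → ℝ) (hS : BondShareGK)
    (hB : MidBondAbelFloorAt Λ) (hH : MidBondNoHoleAt Λ) : ConductanceLowerBound := by
  intro ω₂ lam β γ hω hl hβ hγ huniq μ hμ T hT D hD
  obtain ⟨m, hm, N₁, hN₁⟩ := hB ω₂ lam β γ hω hl hβ hγ T hT
  obtain ⟨θ, hθ, N₂, hN₂⟩ := hH ω₂ lam β γ hω hl hβ hγ T hT
  refine ⟨θ * m, mul_pos hθ hm, max (max N₁ N₂) 2, fun N hN => ?_⟩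
  have h1 : N₁ ≤ N := le_trans (le_trans (le_max_left _ _) (le_max_left _ _)) hN
  have h2 : N₂ ≤ N := le_trans (le_trans (le_max_right _ _) (le_max_left _ _)) hN
  have h3 : 2 ≤ N := le_trans (le_max_right _ _) hN
  have hN1 : 0 < (N : ℝ) - 1 := by
    have : (2 : ℝ) ≤ N := by exact_mod_cast h3
    linarith
  have hT2 : 0 < T ^ 2 := by positivity
  have hpos : 0 < ((N : ℝ) - 1) * T ^ 2 := mul_pos hN1 hT2
  rw [response_eq_gk hω hl hβ hγ huniq hμ hT hD h3, le_div_iff₀ hpos,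
    hS ω₂ lam β γ hω hl hβ hγ T hT N h3]
  have key : θ * m * T ^ 2 ≤ gkMid ω₂ lam β γ T N :=
    calc θ * m * T ^ 2 = θ * (m * T ^ 2) := by ring
      _ ≤ θ * abelMid ω₂ lam β γ T N (Λ N) := mul_le_mul_of_nonneg_left (hN₁ N h1) hθ.le
      _ ≤ gkMid ω₂ lam β γ T N := hN₂ N h2
  calc θ * m * (((N : ℝ) - 1) * T ^ 2) = ((N : ℝ) - 1) * (θ * m * T ^ 2) := by ring
    _ ≤ ((N : ℝ) - 1) * gkMid ω₂ lam β γ T N := mul_le_mul_of_nonneg_left key hN1.le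

/-- The logarithmically reduced ballistic rate `Λ N = C₀ · log(N+2) / (N+1)` (`C₀` = twice a
propagation-speed bound; `2v` with BCDM-type `t log^α t` cones up to the logarithm). -/
def midRate (C₀ : ℝ) (N : ℕ) : ℝ := C₀ * Real.log ((N : ℝ) + 2) / ((N : ℝ) + 1)

theorem midRate_pos {C₀ : ℝ} (hC : 0 < C₀) (N : ℕ) : 0 < midRate C₀ N := by
  unfold midRate
  have h2 : (1 : ℝ) < (N : ℝ) + 2 := by
    have : (0 : ℝ) ≤ N := by exact_mod_cast Nat.zero_le N
    linarith
  have hlog : 0 < Real.log ((N : ℝ) + 2) := Real.log_pos h2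
  positivity

/-! ## §2 The fixed-rate anchor and the DC/AC ratio form of the crux -/

/-- **ABEL ANCHOR** (census S-C): at every FIXED rate `l > 0` the Abel mean is extensive,
`abelGK N l ≥ m(l)·(N−1)T²` eventually.  Provable now and `N`-uniform (sketch in the census:
`abelGK(l) = l‖v_l‖² + ‖v_l‖²_S ≥ l‖v_l‖²` for the resolvent current field `(l − L)v_l = J`, and
`‖v_l‖ ≥ ⟨J,J⟩/‖(l − L*)J‖` with `⟨J,J⟩ ≥ c₀(N−1)`, `‖(l−L*)J‖² ≤ C(N−1)` from Gibbs statics),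
but `m(l) → 0` as `l → 0`: it does not touch the crux. -/
def AbelAnchor : Prop :=
  ∀ ω₂ lam β γ : ℝ, 0 < ω₂ → 0 < lam → 0 < β → 0 < γ → ∀ T : ℝ, 0 < T → ∀ l : ℝ, 0 < l →
    ∃ m : ℝ, 0 < m ∧ ∃ N₁ : ℕ, ∀ N : ℕ, N₁ ≤ N →
      m * (((N : ℝ) - 1) * T ^ 2) ≤ abelGK ω₂ lam β γ T N l

/-- **DC/AC RATIO** (census S-C): for some fixed rate `l > 0`, `gk N ≥ θ·abelGK N l` eventually —
the DC conductance keeps a fraction of the Abel-smoothed conductance at frequency `l`.  Given the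
anchor this IS the crux (below) and, given a ceiling `abelGK N l ≤ C(N−1)`, the crux implies it:
a reformulation, recorded as such. -/
def DcAcRatio : Prop :=
  ∀ ω₂ lam β γ : ℝ, 0 < ω₂ → 0 < lam → 0 < β → 0 < γ → ∀ T : ℝ, 0 < T →
    ∃ l : ℝ, 0 < l ∧ ∃ θ : ℝ, 0 < θ ∧ ∃ N₂ : ℕ, ∀ N : ℕ, N₂ ≤ N →
      θ * abelGK ω₂ lam β γ T N l ≤ gk ω₂ lam β γ T N

/-- **GLUE (proved): `AbelAnchor → DcAcRatio → ConductanceLowerBound`.** -/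
theorem conductanceLowerBound_of_dcAcRatio (hA : AbelAnchor) (hR : DcAcRatio) :
    ConductanceLowerBound := by
  intro ω₂ lam β γ hω hl hβ hγ huniq μ hμ T hT D hD
  obtain ⟨l, hl0, θ, hθ, N₂, hN₂⟩ := hR ω₂ lam β γ hω hl hβ hγ T hT
  obtain ⟨m, hm, N₁, hN₁⟩ := hA ω₂ lam β γ hω hl hβ hγ T hT l hl0
  refine ⟨θ * m, mul_pos hθ hm, max (max N₁ N₂) 2, fun N hN => ?_⟩
  have h1 : N₁ ≤ N := le_trans (le_trans (le_max_left _ _) (le_max_left _ _)) hN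
  have h2 : N₂ ≤ N := le_trans (le_trans (le_max_right _ _) (le_max_left _ _)) hN
  have h3 : 2 ≤ N := le_trans (le_max_right _ _) hN
  have hpos : 0 < ((N : ℝ) - 1) * T ^ 2 := by
    have : (2 : ℝ) ≤ N := by exact_mod_cast h3
    have hN1 : 0 < (N : ℝ) - 1 := by linarith
    positivity
  rw [response_eq_gk hω hl hβ hγ huniq hμ hT hD h3, le_div_iff₀ hpos]
  calc θ * m * (((N : ℝ) - 1) * T ^ 2) = θ * (m * (((N : ℝ) - 1) * T ^ 2)) := by ring
    _ ≤ θ * abelGK ω₂ lam β γ T N l := mul_le_mul_of_nonneg_left (hN₁ N h1) hθ.le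
    _ ≤ gk ω₂ lam β γ T N := hN₂ N h2

/-! ## §3 Strengthening S-A: quasi-monotone response and resistance doubling -/

/-- **QUASI-MONOTONE RESPONSE** (census S-A): in the crux frame, `∃ θ > 0, ∀ 2 ≤ N ≤ M, θ·D_N ≤ D_M`
— lengthening the chain never costs more than a fixed factor of the total response.  With the
closed `PositiveConductance` it implies the crux (below); conversely crux + bounded response give
it: an impedance comparison of chains of different lengths with no sign principle (census). -/
def QuasiMonotoneResponse : Prop :=
  ∀ ω₂ lam β γ : ℝ, 0 < ω₂ → 0 < lam → 0 < β → 0 < γ →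
    (∀ (N : ℕ) (T_L T_R : ℝ), 0 < T_L → 0 < T_R → ∀ μ ν : Measure (PhaseSpace N),
      (pinnedChain ω₂ lam β γ).IsSteadyState N T_L T_R μ →
      (pinnedChain ω₂ lam β γ).IsSteadyState N T_L T_R ν → μ = ν) →
    ∀ μ : (N : ℕ) → ℝ → ℝ → Measure (PhaseSpace N),
      (∀ (N : ℕ) (T_L T_R : ℝ), 0 < T_L → 0 < T_R →
        (pinnedChain ω₂ lam β γ).IsSteadyState N T_L T_R (μ N T_L T_R)) →
      ∀ T : ℝ, 0 < T → ∀ D : ℕ → ℝ,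
        (∀ N : ℕ, Tendsto (fun δ : ℝ =>
          (pinnedChain ω₂ lam β γ).totalCurrent (μ N (T + δ / 2) (T - δ / 2)) / δ)
            (𝓝[≠] 0) (𝓝 (D N))) →
        ∃ θ : ℝ, 0 < θ ∧ ∀ N M : ℕ, 2 ≤ N → N ≤ M → θ * D N ≤ D M

/-- **`QuasiMonotoneResponse → PositiveConductance → ConductanceLowerBound`** (proved; `c = θ·D 2`). -/
theorem conductanceLowerBound_of_quasiMonotone
    (hQ : QuasiMonotoneResponse) (hP : PositiveConductance) : ConductanceLowerBound := by
  intro ω₂ lam β γ hω hl hβ hγ huniq μ hμ T hT D hD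
  obtain ⟨θ, hθ, hθN⟩ := hQ ω₂ lam β γ hω hl hβ hγ huniq μ hμ T hT D hD
  have h2 : 0 < D 2 := hP ω₂ lam β γ hω hl hβ hγ huniq μ hμ T hT D hD 2 le_rfl
  exact ⟨θ * D 2, mul_pos hθ h2, 2, fun N hN => hθN 2 N le_rfl hN⟩

/-- **RESISTANCE DOUBLING** (census S-A, multiplicative form): `∃ C, ∀ N ≥ 2, R_{2N} ≤ C·R_N` with
`R_N := (N−1)/D_N`.  Strictly weaker than quasi-subadditivity; iterating gives only the power law
`D_N ≳ N^{1 − log₂ C}`, which is the crux exactly at `C = 2` — zero slack (census).  Stated only. -/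
def DoublingResistance : Prop :=
  ∀ ω₂ lam β γ : ℝ, 0 < ω₂ → 0 < lam → 0 < β → 0 < γ →
    (∀ (N : ℕ) (T_L T_R : ℝ), 0 < T_L → 0 < T_R → ∀ μ ν : Measure (PhaseSpace N),
      (pinnedChain ω₂ lam β γ).IsSteadyState N T_L T_R μ →
      (pinnedChain ω₂ lam β γ).IsSteadyState N T_L T_R ν → μ = ν) →
    ∀ μ : (N : ℕ) → ℝ → ℝ → Measure (PhaseSpace N),
      (∀ (N : ℕ) (T_L T_R : ℝ), 0 < T_L → 0 < T_R →
        (pinnedChain ω₂ lam β γ).IsSteadyState N T_L T_R (μ N T_L T_R)) →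
      ∀ T : ℝ, 0 < T → ∀ D : ℕ → ℝ,
        (∀ N : ℕ, Tendsto (fun δ : ℝ =>
          (pinnedChain ω₂ lam β γ).totalCurrent (μ N (T + δ / 2) (T - δ / 2)) / δ)
            (𝓝[≠] 0) (𝓝 (D N))) →
        (∀ N : ℕ, 2 ≤ N → 0 < D N) →
        ∃ C : ℝ, ∀ N : ℕ, 2 ≤ N →
          ((2 * N : ℝ) - 1) / D (2 * N) ≤ C * (((N : ℝ) - 1) / D N)

end Summit.AtomisticToContinuum.FouriersLaw.Cruxes.ConductanceLowerBound.StrategyCensus2CP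

end
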